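import Summits.QuantumFields.YangMills.Theorems.BalabanUVNodesN10AtRecord11B13WalksBlockMonomialHolo
import Literature.MathematicalPhysics.QuantumFieldTheory.Balaban1983to89.B13EntrywiseWalks

/-!
# BalabanUVNodes ∕ N10 AT NODE 00's [B13] GROUP OF RECORD, ENTRYWISE EDITION — NODE A's per-term datum is TWO ENTRYWISE LETTERS of the σ-free
# fluctuation operator on the complex ball ((3.108)-type decay, holomorphy) + ONE GEOMETRIC LETTER on the cube decoration of bond PAIRS + the REAL LOCAL
# averaging operator `C` of (2.5); module 21's structured binder `hKexp` is a THEOREM of that datum (Track A, DAG node N10 [B13]; seat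
# `pub-ymgap-dag-n10-c` g4, module 32 — the junction edition of ym-nodeO-ideate P2 g30's reduction, tree module `B13EntrywiseWalks` = module 31)

HONEST FRAMING.  Count-neutral kernel bookkeeping: module 21 (`…WalksBlockMonomialHolo.b13LeafOfRecord_of_located_conditionedMonomialHolo`) with its binder
`hKexp` REPLACED by ENTRYWISE data (P2 g30, memo ROUTE-P2 §S56: «for everything `hKexp` consumes, the σ-free slot is equivalent in strength to entrywise
decay + holomorphy of the FINAL operator; the walk indexing is free at the junction»): per (2.14)-term, `RawEntryLetters (Δ₀ Z t) (locF Z t) rf.R ρ B`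
(decay `‖Δ₀(u)_{ij}‖ ≤ Be^{−ρd₁(i,j)}`, entrywise holomorphy on the complex `rf.R`-ball — [13] Thm 3.10's (3.108) AS A PROPERTY OF THE OPERATOR, at complex
backgrounds per [II] p. 15), a fibre bound, `GeodesicDecoration (J Z t) (locF Z t) (𝒦 Z t).X c₀ M₁` ((1.11)'s cube count along a geodesic through the
σ-region), the numerics `0 < η ≤ ε < ρ`, `2κ₁ ≤ ηM₁`, the real local `C Z t` with its two letters, a junction rate, three letter-match inequalities, and
the DEFINITION `hKK` of `KK Z t` as `Cᵀ·sDecorate(J′, ½raw ⊕ ½rawᵀ)·C` (the Hadamard-type conditioning of the symmetrized entry packaging — NOT print's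
walk-by-walk `Δ_k(σ)`; the junction asks accretivity at the reference point only, `hKacc`, so nothing printed is lost; class A0 «object identity» of the
census is the term tower's, see `HOME/pub-ymgap-dag-n10-c/N10-RESIDUAL-CENSUS-v5.md`).  `hKexp` is DERIVED inside by
`B13EntrywiseWalks.structuredExpansion_sandwich_rawEntrywise` + `B13JointWalkExpansionSymmetrize.jointWalkExpansion_congr_on` + `JointWalkExpansion.mono`.
Every other binder of module 21 verbatim, same order, same conclusion.  Sibling: `…WalksBlockSigmaFree` (module 30: the σ-free JOINT-WALK-EXPANSION form with
an affine-absorbed decoration — the road of record for kernels BUILT by [13]'s parametrix × Neumann construction).  Nothing of Bałaban's is asserted; N10 is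
NOT discharged; K0‴∕K1‴ untouched; no node count moves; Stage-3-keyed (record-stage-generic); one finite four-torus programme at fixed ε per run; nothing
continuum ∕ ℝ⁴ ∕ OS ∕ mass-gap ∕ Clay.  0 `sorry`, 0 `def`, standard axioms.  Filed `--supports` K1‴ «StabilityBAtRecordR13e» (stmt-QuantumFields-19910)
`--as helper` of route «BalabanUVNodes».
-/

noncomputable section

namespace Summit.QuantumFields.YangMills.BalabanUVNodes.N10AtRecord11B13WalksBlockEntrywise


open Literature.MathematicalPhysics.QuantumFieldTheory.Balaban1983to89
open Literature.MathematicalPhysics.QuantumFieldTheory.Balaban1983to89.DagBinding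
open Literature.MathematicalPhysics.QuantumFieldTheory.Balaban1983to89.Node00
open Literature.MathematicalPhysics.QuantumFieldTheory.Balaban1983to89.B13Lemma3Torus (TwoTorusStep)
open Literature.MathematicalPhysics.QuantumFieldTheory.Balaban1983to89.B13Lemma3TorusSocket (TermDomination Lemma3Numerics)
open Literature.MathematicalPhysics.QuantumFieldTheory.Balaban1983to89.B13Lemma3TorusData
open Metric
open Literature.MathematicalPhysics.QuantumFieldTheory.Balaban1983to89.B16Absorption (pbox)
open Literature.MathematicalPhysics.QuantumFieldTheory.Balaban1983to89.TreeLengthTorus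
open Literature.MathematicalPhysics.QuantumFieldTheory.Balaban1983to89.TreeLengthTorusGeometry
open Literature.MathematicalPhysics.QuantumFieldTheory.Balaban1983to89.TreeLengthTorusTransfer
open Literature.MathematicalPhysics.QuantumFieldTheory.Balaban1983to89.B12TreeDecay (kappa₀ K₀)
open Literature.MathematicalPhysics.QuantumFieldTheory.Balaban1983to89.B13PkScaling (Qop scaled)
open Literature.MathematicalPhysics.QuantumFieldTheory.Balaban1983to89.B13Bound143 (invTau R12)
open Literature.MathematicalPhysics.QuantumFieldTheory.Balaban1983to89.B13Term214 (term214 SepHolOn core214 F214)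
open Literature.MathematicalPhysics.QuantumFieldTheory.Balaban1983to89.B13Lemma3TorusTerms (terms Z0)
open Literature.MathematicalPhysics.QuantumFieldTheory.Balaban1983to89.B5TorusCover (UT)
open Literature.MathematicalPhysics.QuantumFieldTheory.Balaban1983to89.B13TermWalkData (TermKernels)
open Literature.MathematicalPhysics.QuantumFieldTheory.Balaban1983to89.NodeOLettersOfWalksAcross (WalkPackage TermWalks)
open Literature.MathematicalPhysics.QuantumFieldTheory.Balaban1983to89.NodeOLettersOfWalksPerturbative
  (RefPackage TermWalksRef termWalks_of_ref_thresholds)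
open Literature.MathematicalPhysics.QuantumFieldTheory.Balaban1983to89.NodeOLettersOfWalksAcross (WalkPackage)
open Literature.MathematicalPhysics.QuantumFieldTheory.Balaban1983to89.B13NodeTorusWalks (exchange_of_thresholds)
open Literature.MathematicalPhysics.QuantumFieldTheory.Balaban1983to89.B13NodeTorusWalksHolo (b13Leaf_twoTorus_walksRefHolo)
open Literature.MathematicalPhysics.QuantumFieldTheory.Balaban1983to89.B13JointWalkExpansion (JointWalkExpansion)
open Literature.MathematicalPhysics.QuantumFieldTheory.Balaban1983to89.B13Sqrt27Accretive (invSqrt)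
open Literature.MathematicalPhysics.QuantumFieldTheory.Balaban1983to89.B9Thm37GlueTorus (tdist1)
open Literature.MathematicalPhysics.QuantumFieldTheory.Balaban1983to89.B13ConditioningBlockWalks (termWalksRef_of_conditionedBlocks_at)
open Literature.MathematicalPhysics.QuantumFieldTheory.Balaban1983to89.B13ConditioningSigmaLetters
  (isSymm_A2_of_reversal differentiableOn_A2_of_monomial differentiableOn_G2_of_monomial)
open scoped Matrix
open Literature.MathematicalPhysics.QuantumFieldTheory.Balaban1983to89.B13Eq111SDecoupling (sDecorate)
open Literature.MathematicalPhysics.QuantumFieldTheory.Balaban1983to89.B13EntrywiseWalks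
  (RawEntryLetters GeodesicDecoration rawEntryTerm structuredExpansion_sandwich_rawEntrywise)
open Literature.MathematicalPhysics.QuantumFieldTheory.Balaban1983to89.B13JointWalkExpansionSymmetrize (jointWalkExpansion_congr_on)
open Summit.QuantumFields.YangMills.BalabanUVNodes.N10AtRecord11B13WalksBlockMonomialHolo (b13LeafOfRecord_of_located_conditionedMonomialHolo)

/-! ## §1. THE ENTRYWISE EDITION (Stage 3) -/

section Group

variable (θ : Stage3Params) (lam : ResidB13 θ)

-- the junction elaborates ≈ 185 binders and a 150-argument `exact`; twice the default budget (as in the sibling N10 junction files)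
set_option maxHeartbeats 400000 in
open Classical in
/-- **THE [B13] LEAF AT NODE 00's GROUP OF RECORD FROM ENTRYWISE NODE-A LETTERS.**  Exactly module 21's
`b13LeafOfRecord_of_located_conditionedMonomialHolo` (same conclusion `B13LeafOfRecord θ lam`, binders in the same order) except: `hKexp` REPLACED by
`P locF Δ₀` + `hEL` (two entrywise letters per term) + `hfibF` + `J hGJ` (the geodesic cube-count letter) + `hηΔ hηε hρε hP2` (the (1.11) numerics) +
`C hCle hCsupp` (the real local averaging operator) + `hμΔ hμε hμκ hκεΔ` + `hεP hkapP hKP` (letter match) + `hKK` (the definition of `KK Z t`).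
DERIVED inside: module 21's `hKexp` — by `structuredExpansion_sandwich_rawEntrywise`, transported to `KK Z t` along `hKK`, weakened to `rf`'s letters.
[cite: Balaban1988RG2Cluster, Lemma 1 p.9, Lemma 2 p.11, Lemma 3 p.20, p.3, (1.11) p.5, (2.5)–(2.7) pp.12–13, p.15, (2.14)–(2.26) pp.15–17; Balaban1985BackgroundPropagators, (3.93) p.410, Thm 3.10 (3.107)–(3.108) p.416, Thm 3.12 p.423] -/
theorem b13LeafOfRecord_of_located_entrywise
    (hN12 : 12 ≤ (θ.ℓ₆ + 1) * (lam.n + 1))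
    -- (1) LEMMA 1: [I]'s block geometry of the (1.33) index families of the layer
    (dist : TDom 4 ((θ.ℓ₆ + 1) * (lam.n + 1)) → TPt 4 ((θ.ℓ₆ + 1) * (lam.n + 1)) → (j : ℕ) →
      TPt 4 ((θ.ℓ₆ + 1) ^ (lam.k - j) * ((θ.ℓ₆ + 1) * (lam.n + 1))) → ℝ) {K K' : ℝ}
    (hS0Y : ∀ Y, ∀ a ∈ lam.S0 Y,
      (pbox (fun i => natLift a i - (5 : ℕ)) (fun i => natLift a i + 1 + (5 : ℕ))).image (proj ((θ.ℓ₆ + 1) * (lam.n + 1))) ⊆ Y.1)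
    (hFsub : ∀ Y a, lam.F Y a ⊆
      (pbox (fun i => natLift a i - (5 : ℕ)) (fun i => natLift a i + 1 + (5 : ℕ))).image (proj ((θ.ℓ₆ + 1) * (lam.n + 1))) \
        (pbox (fun i => natLift a i - (4 : ℕ)) (fun i => natLift a i + 1 + (4 : ℕ))).image (proj ((θ.ℓ₆ + 1) * (lam.n + 1))))
    (hSq : ∀ Y, ∀ a ∈ lam.S0 Y, ∀ j, lam.Sq Y a j ⊆
      (Finset.univ : Finset (TPt 4 ((θ.ℓ₆ + 1) ^ (lam.k - j) * ((θ.ℓ₆ + 1) * (lam.n + 1))))).filter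
        (fun q => tcoarse ((θ.ℓ₆ + 1) ^ (lam.k - j)) ((θ.ℓ₆ + 1) * (lam.n + 1)) q ∈
          (pbox (fun i => natLift a i - (2 : ℕ)) (fun i => natLift a i + 1 + (2 : ℕ))).image (proj ((θ.ℓ₆ + 1) * (lam.n + 1)))))
    (hScY : ∀ Y, lam.Sc Y ⊆ Y.1)
    (hdist0 : ∀ Y a j q, 0 ≤ lam.c.δ₀ * dist Y a j q)
    (hdist : ∀ Y a j (n : ℕ) q, q ∉ (pbox (fun i => (((θ.ℓ₆ + 1) ^ (lam.k - j) : ℕ) : ℤ) * natLift a i - (n + 1 : ℕ))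
      (fun i => (((θ.ℓ₆ + 1) ^ (lam.k - j) : ℕ) : ℤ) * natLift a i + 2 * (((θ.ℓ₆ + 1) ^ (lam.k - j) : ℕ) : ℤ) - 1 + (n + 1 : ℕ))).image
        (proj ((θ.ℓ₆ + 1) ^ (lam.k - j) * ((θ.ℓ₆ + 1) * (lam.n + 1)))) → lam.c.δ₀ * lam.c.M * ((n : ℝ) + 1) ≤ lam.c.δ₀ * dist Y a j q)
    (hSX : ∀ Y a j q, lam.SX Y a j q ⊆ (tcubeSys 4 ((θ.ℓ₆ + 1) ^ (lam.k - j) * ((θ.ℓ₆ + 1) * (lam.n + 1)))).above q)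
    (hSX' : ∀ Y a j q, lam.SX' Y a j q ⊆ (tcubeSys 4 ((θ.ℓ₆ + 1) ^ (lam.k - j) * ((θ.ℓ₆ + 1) * (lam.n + 1)))).above q)
    (hX0 : ∀ Y, ∀ a ∈ lam.Sc Y, ∀ j ∈ Finset.range (lam.k + 1), ∀ q ∈ lam.Sq' Y a j, ∀ x ∈ lam.SX' Y a j q,
      x.1.image (tcoarse ((θ.ℓ₆ + 1) ^ (lam.k - j)) ((θ.ℓ₆ + 1) * (lam.n + 1))) ⊆ Y.1)
    -- (1) LEMMA 1: per-term analyticity on (1.34)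
    (hAnT : ∀ Y, ∀ a ∈ lam.S0 Y, ∀ X ∈ (lam.F Y a).powerset, ∀ j ∈ Finset.range (lam.k + 1), ∀ q ∈ lam.Sq Y a j,
      ∀ x ∈ lam.SX Y a j q, AnalyticOnNhd ℂ (lam.T Y a X j q x) (lam.sp1 Y))
    (hAnT' : ∀ Y, ∀ a ∈ lam.Sc Y, ∀ j ∈ Finset.range (lam.k + 1), ∀ q ∈ lam.Sq' Y a j, ∀ x ∈ lam.SX' Y a j q,
      AnalyticOnNhd ℂ (lam.T' Y a j q x) (lam.sp1 Y))
    -- (1) LEMMA 1: thresholds and restrictions on the residual constants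
    (hK : 0 ≤ K) (hK' : 0 ≤ K') (hκ : 0 ≤ lam.c.κ) (hδ1 : lam.c.δ < 1) (hδκ : 1 ≤ lam.c.δ * lam.c.κ)
    (hκ126 : kappa₀ 64 8 ≤ lam.c.κ) (hκ126' : kappa₀ 64 8 ≤ lam.c.δ * lam.c.κ)
    (hκ₁ : 1 + 2 * Real.log (8 * 12 ^ 3) ≤ lam.c.κ₁) (hκ₁' : 2 + 16 * Real.log 128 ≤ lam.c.κ₁)
    (hδ₀M : 10 * Real.exp (-1) ≤ lam.c.δ₀ * lam.c.M) (hδ₀M5 : 2 * Real.log 5 ≤ lam.c.δ₀ * lam.c.M)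
    (hR8 : (1 - lam.c.δ) * lam.c.κ ≤ (1 / 4) * (lam.c.κ₁ - 1)) (hR9 : (1 - 2 * lam.c.δ) * lam.c.κ ≤ (1 / 16) * lam.c.κ₁)
    -- (1) LEMMA 1: per-term (1.24), (1.30) by reference to [I] (3.54), (3.17), [15] Prop. 4, [13] (3.108); the constants with headroom (1 − θ₁)
    (h124 : ∀ Y φ, φ ∈ lam.sp1 Y → ∀ a ∈ lam.S0 Y, ∀ X ∈ (lam.F Y a).powerset, ∀ j ∈ Finset.range (lam.k + 1), ∀ q ∈ lam.Sq Y a j,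
      ∀ x ∈ lam.SX Y a j q,
        ‖lam.T Y a X j q x φ‖ ≤ K * (((θ.ℓ₆ + 1 : ℕ) : ℝ) ^ j * (((θ.ℓ₆ + 1 : ℕ) : ℝ) ^ lam.k)⁻¹) ^ 5 *
          Real.exp (-(lam.c.κ₁ - 1) *
            (((Y.1 \ (pbox (fun i => natLift a i - (5 : ℕ)) (fun i => natLift a i + 1 + (5 : ℕ))).image
              (proj ((θ.ℓ₆ + 1) * (lam.n + 1)))).card : ℝ) + X.card)) *
          Real.exp (-(lam.c.κ * torusTreeLen x.1)))
    (h130 : ∀ Y φ, φ ∈ lam.sp1 Y → ∀ a ∈ lam.Sc Y, ∀ j ∈ Finset.range (lam.k + 1), ∀ q ∈ lam.Sq' Y a j,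
      ∀ x ∈ lam.SX' Y a j q,
        ‖lam.T' Y a j q x φ‖ ≤ K' * Real.exp (-(1 / 2) * (lam.c.δ₀ * lam.c.M) * (((θ.ℓ₆ + 1 : ℕ) : ℝ) ^ j * (((θ.ℓ₆ + 1 : ℕ) : ℝ) ^ lam.k)⁻¹)⁻¹
            - (1 / 2) * lam.c.δ₀ * dist Y a j q) *
          Real.exp (-(lam.c.κ₁ - 1) * ((Y.1 \ x.1.image (tcoarse ((θ.ℓ₆ + 1) ^ (lam.k - j)) ((θ.ℓ₆ + 1) * (lam.n + 1)))).card : ℝ)) *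
          Real.exp (-(lam.c.κ * torusTreeLen x.1)))
    {θ₁ : ℝ} (hθ₁0 : 0 ≤ θ₁) (hθ₁1 : θ₁ < 1)
    (hC : K * K₀ 64 8 * (2 * (6 * ((θ.ℓ₆ + 1 : ℕ) : ℝ)) ^ 4) * Real.exp 1 * Real.exp ((1 / 8) * lam.c.κ₁ * (12 ^ 4 - 1)) +
        2 * (64 * K') * K₀ 64 8 * 1344 ≤
      (1 - θ₁) * (lam.c.E₀ * lam.c.ε₁ * lam.c.C₁ * lam.c.M ^ lam.c.q * Real.exp (lam.c.C₂ * lam.c.κ₁)))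
    -- (2) LEMMA 2 (pp. 10–11): the curvature terms; the located per-term data of `B13Lemma2Torus.lemma2Printed_twoTorus'` for the layer's plaquette data
    (hGlAn : ∀ Y, AnalyticOnNhd ℂ (lam.Gl Y) (lam.sp1 Y))
    (hGl : ∀ Y φ, φ ∈ lam.sp1 Y → ‖lam.Gl Y φ‖ ≤ θ₁ * (lam.c.E₀ * lam.c.ε₁ * lam.c.C₁ * lam.c.M ^ lam.c.q * Real.exp (lam.c.C₂ * lam.c.κ₁)) *
      Real.exp (-((1 - 2 * lam.c.δ) * lam.c.κ * (tsys 4 ((θ.ℓ₆ + 1) * (lam.n + 1))).dj Y)))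
    (he : ∀ Y b, ‖lam.e Y b‖ ≤ 1) (hg : lam.g ≠ 0)
    {R K₂ : ℝ} {m₂ : ℕ} (hK₂ : 0 ≤ K₂) (hR : 0 < R) (hε3 : 3 * lam.c.ε₁ ≤ R)
    (hW : ∀ Y, ∀ i ∈ lam.s Y, ∀ φ ∈ lam.sp1 Y, AnalyticOnNhd ℂ (lam.Wf Y i φ) (ball 0 R))
    (hKW : ∀ Y, ∀ i ∈ lam.s Y, ∀ φ ∈ lam.sp1 Y, ∀ z ∈ ball (0 : lam.E) R,
      ‖lam.Wf Y i φ z‖ ≤ K₂ * Real.exp (-(lam.c.κ₁ - 1) * ((Y.1.card : ℝ) - 1)) * ‖z‖ ^ 3)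
    (hcard : ∀ Y, (lam.s Y).card ≤ m₂ * Y.1.card)
    (hsp : ∀ Y φ, φ ∈ lam.sp1 Y → ‖lam.g‖ * ‖lam.rd Y φ‖ < lam.c.ε₁)
    (hfloor : 27 * m₂ * K₂ * Real.exp (lam.c.κ₁ - 1) ≤ lam.c.C₃ * lam.c.M ^ 4 * Real.exp (lam.c.C₂ * lam.c.κ₁))
    (hAnP : ∀ Y, ∀ i ∈ lam.s Y, AnalyticOnNhd ℂ (fun φ => scaled lam.g (lam.Wf Y i φ) (lam.rd Y φ)) (lam.sp1 Y))
    (hG : ∀ Y, lam.GaugeInv (lam.V Y) ∧ lam.GaugeInv ((WtOfRecord θ lam).toStepData.quadForm Y) ∧ lam.GaugeInv (lam.Vpp Y))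
    -- (3) LEMMA 3 (pp. 14–20): the signs of (2.18)–(2.20), R12, |τ(Y)| ≥ 2, and the numerics bundle at ℓ = ½L
    (hL8 : 8 ≤ θ.ℓ₆ + 1) {a a₂ a₂' a₅ Aabs : ℝ} (hN : Lemma3Numerics (c13OfRecord θ lam) (lam.m₃ + 1) (((θ.ℓ₆ + 1 : ℕ) : ℝ) / 2) a a₂ a₂' a₅ Aabs)
    (h12 : R12 (c13OfRecord θ lam)) (hE : 0 < lam.c.E₀) (hε : 0 < lam.c.ε₁) (hC₁ : 0 < lam.c.C₁) (hα : 0 < lam.c.α₄)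
    (hM : 1 ≤ lam.c.M)
    (hτ2 : lam.c.E₀ * lam.c.ε₁ * lam.c.C₁ * lam.c.α₄⁻¹ * lam.c.M ^ lam.c.q * Real.exp (lam.c.C₂ * lam.c.κ₁) ≤ 1 / 2)
    -- (3) the Cauchy radius and the parameter domains (p. 15)
    -- the bigger σ-polydisc (a second constants record `cp` lending its `κ₁`; NODE A's kernels are tagged at `cp`) and a
    -- Cauchy radius `r ≤ 1`; the τ-regions are the open discs of radii `2|τ(Y)|` (chosen inside)
    (cp : B13.Consts) (hκp : lam.c.κ₁ < cp.κ₁) {r : ℝ} (hr : 0 < r) (hr1 : r ≤ 1)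
    -- (3) THE DICTIONARY: per term (𝐃, P) of every Z ∈ 𝐃_{k+1}, the kernel data `𝒦 Z t` on a site torus `UT Nf` with
    --     configuration space `E₃`, and the configuration `u = uOf Z t φ` of `φ ∈ sp2 Z`, of size ≤ α
    {ν : ℕ} {Nf : Fin ν → ℕ} [∀ i, NeZero (Nf i)]
    {E₃ : Type*} [NormedAddCommGroup E₃] [NormedSpace ℂ E₃]
    (𝒦 : TDom 4 (lam.n + 1) → Finset (TDom 4 ((θ.ℓ₆ + 1) * (lam.n + 1))) × Finset (TBond 4 (lam.m₃ + 1) ((θ.ℓ₆ + 1) * (lam.n + 1))) → TermKernels cp 4 (lam.n + 1) ν Nf E₃)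
    [∀ Z t, Fintype (𝒦 Z t).C₀] [∀ Z t, DecidableEq (𝒦 Z t).C₀]
    (uOf : (Z : TDom 4 (lam.n + 1)) → (t : Finset (TDom 4 ((θ.ℓ₆ + 1) * (lam.n + 1))) × Finset (TBond 4 (lam.m₃ + 1) ((θ.ℓ₆ + 1) * (lam.n + 1)))) → lam.Φ → E₃)
    {α : ℝ} (hαnn : 0 ≤ α) (huα : ∀ Z, ∀ t ∈ terms (θ.ℓ₆ + 1) (lam.m₃ + 1) Z, ∀ φ ∈ lam.sp2 Z, ‖uOf Z t φ‖ ≤ α)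
    -- (3) per term: parameter lists, the linear map Γ(σ), characteristic functions, potentials
    (lZ : TDom 4 (lam.n + 1) → Finset (TDom 4 ((θ.ℓ₆ + 1) * (lam.n + 1))) × Finset (TBond 4 (lam.m₃ + 1) ((θ.ℓ₆ + 1) * (lam.n + 1))) → List (TPt 4 (lam.n + 1)))
    (hlZ : ∀ Z, ∀ t ∈ terms (θ.ℓ₆ + 1) (lam.m₃ + 1) Z, (lZ Z t).Nodup ∧ (lZ Z t).toFinset = Z.1 \ tclosure (θ.ℓ₆ + 1) (lam.n + 1) (Z0 (lam.m₃ + 1) t))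
    (lD : TDom 4 (lam.n + 1) → Finset (TDom 4 ((θ.ℓ₆ + 1) * (lam.n + 1))) × Finset (TBond 4 (lam.m₃ + 1) ((θ.ℓ₆ + 1) * (lam.n + 1))) → List (TDom 4 ((θ.ℓ₆ + 1) * (lam.n + 1))))
    (hlD : ∀ Z, ∀ t ∈ terms (θ.ℓ₆ + 1) (lam.m₃ + 1) Z, (lD Z t).Nodup ∧ (lD Z t).toFinset = t.1)
    (Γm : (Z : TDom 4 (lam.n + 1)) → (t : Finset (TDom 4 ((θ.ℓ₆ + 1) * (lam.n + 1))) × Finset (TBond 4 (lam.m₃ + 1) ((θ.ℓ₆ + 1) * (lam.n + 1)))) → lam.Φ →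
      (TPt 4 (lam.n + 1) → ℂ) → ((𝒦 Z t).Λ ⊕ (𝒦 Z t).C₀ → ℝ) → ((𝒦 Z t).Λ → ℂ))
    (χY₀ χcP : (Z : TDom 4 (lam.n + 1)) → (t : Finset (TDom 4 ((θ.ℓ₆ + 1) * (lam.n + 1))) × Finset (TBond 4 (lam.m₃ + 1) ((θ.ℓ₆ + 1) * (lam.n + 1)))) →
      ((𝒦 Z t).Λ → ℝ) → ℝ)
    (hχ0 : ∀ Z t B, 0 ≤ χY₀ Z t B) (hχ1 : ∀ Z t B, χY₀ Z t B ≤ 1)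
    (Pl : (Z : TDom 4 (lam.n + 1)) → (t : Finset (TDom 4 ((θ.ℓ₆ + 1) * (lam.n + 1))) × Finset (TBond 4 (lam.m₃ + 1) ((θ.ℓ₆ + 1) * (lam.n + 1)))) → Finset (𝒦 Z t).Λ)
    (hPcard : ∀ Z, ∀ t ∈ terms (θ.ℓ₆ + 1) (lam.m₃ + 1) Z, (Pl Z t).card = t.2.card) {rP : ℝ} (hrP : 0 ≤ rP)
    (hχc : ∀ Z t B, χcP Z t B = ∏ b ∈ Pl Z t, (if rP ≤ |B b| then (1 : ℝ) else 0))
    (Dfam : TDom 4 (lam.n + 1) → Finset (TDom 4 ((θ.ℓ₆ + 1) * (lam.n + 1))) × Finset (TBond 4 (lam.m₃ + 1) ((θ.ℓ₆ + 1) * (lam.n + 1))) → Finset (TDom 4 ((θ.ℓ₆ + 1) * (lam.n + 1))))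
    (Vr : (Z : TDom 4 (lam.n + 1)) → (t : Finset (TDom 4 ((θ.ℓ₆ + 1) * (lam.n + 1))) × Finset (TBond 4 (lam.m₃ + 1) ((θ.ℓ₆ + 1) * (lam.n + 1)))) → lam.Φ →
      TDom 4 ((θ.ℓ₆ + 1) * (lam.n + 1)) → ((𝒦 Z t).Λ → ℝ) → ℂ)
    -- (3) THE LAYER's TERM IS (dominated by) THE (2.14) X-INTEGRAL OF NODE A's KERNELS at the configuration — the
    --     dictionary identification; termwise domination of H(Z) = Σ T₃ is then the theorem `termDomination_WtOfRecord`
    (hT₃ : ∀ Z, ∀ t ∈ terms (θ.ℓ₆ + 1) (lam.m₃ + 1) Z, ∀ φ ∈ lam.sp2 Z, ‖lam.T₃ Z t φ‖ ≤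
      ‖term214 r (lZ Z t) (lD Z t)
        (core214 (fun σ => (𝒦 Z t).A2 σ (uOf Z t φ)) (Γm Z t φ)
          (F214 t.2.card (χY₀ Z t) (χcP Z t) (Dfam Z t) (Vr Z t φ))) 0 0‖)
    -- (3) the record's objects behind the terms: bonds, cubes, the real field inside the configurations
    (ιb : (Z : TDom 4 (lam.n + 1)) → (t : Finset (TDom 4 ((θ.ℓ₆ + 1) * (lam.n + 1))) × Finset (TBond 4 (lam.m₃ + 1) ((θ.ℓ₆ + 1) * (lam.n + 1)))) → (𝒦 Z t).Λ → lam.Bond)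
    (hι : ∀ Z t, Function.Injective (ιb Z t)) (cube : lam.Bond → TPt 4 ((θ.ℓ₆ + 1) * (lam.n + 1)))
    (hQsupp : ∀ (Y : TDom 4 ((θ.ℓ₆ + 1) * (lam.n + 1))) φ b b', lam.Q Y φ b b' ≠ 0 → cube b ∈ Y.1 ∧ cube b' ∈ Y.1)
    {m' : ℕ} (hfibc : ∀ Z t (x : TPt 4 ((θ.ℓ₆ + 1) * (lam.n + 1))), (Finset.univ.filter fun j => cube (ιb Z t j) = x).card ≤ m')
    (emb : (Z : TDom 4 (lam.n + 1)) → (t : Finset (TDom 4 ((θ.ℓ₆ + 1) * (lam.n + 1))) × Finset (TBond 4 (lam.m₃ + 1) ((θ.ℓ₆ + 1) * (lam.n + 1)))) → lam.Φ →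
      ((𝒦 Z t).Λ → ℝ) → lam.Φ)
    (hBv : ∀ Z t φ B b, lam.Bv (emb Z t φ B) (ιb Z t b) = (B b : ℂ))
    (hBv0 : ∀ Z t φ B b', b' ∉ Set.range (ιb Z t) → lam.Bv (emb Z t φ B) b' = 0)
    (hVr : ∀ Z, ∀ t ∈ terms (θ.ℓ₆ + 1) (lam.m₃ + 1) Z, ∀ φ ∈ lam.sp2 Z, ∀ Y ∈ Dfam Z t, ∀ B,
      emb Z t φ B ∈ lam.sp1 Y → Vr Z t φ Y B = lam.V Y (emb Z t φ B))
    (hχsupp : ∀ Z, ∀ t ∈ terms (θ.ℓ₆ + 1) (lam.m₃ + 1) Z, ∀ φ ∈ lam.sp2 Z, ∀ B, χY₀ Z t B ≠ 0 → ∀ Y ∈ Dfam Z t,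
      emb Z t φ B ∈ lam.sp1 Y)
    -- (3) measurability of the layer's `χ_{k,Y₀}`, potentials, small-field region in the bond variables
    (hχm : ∀ Z t, Measurable (χY₀ Z t)) (hVm : ∀ Z t φ Y, Measurable (Vr Z t φ Y))
    (hsmallm : ∀ Z t φ, MeasurableSet {B : (𝒦 Z t).Λ → ℝ | ∀ Y ∈ Dfam Z t, emb Z t φ B ∈ lam.sp1 Y})
    -- (3) Γ(σ) = G(σ)· (definitional; complex symmetry and σ-holomorphy are READ OFF the one operator below)
    (hlin : ∀ Z, ∀ t ∈ terms (θ.ℓ₆ + 1) (lam.m₃ + 1) Z, ∀ φ ∈ lam.sp2 Z, ∀ σ : TPt 4 (lam.n + 1) → ℂ, (∀ j, ‖σ j‖ ≤ Real.exp cp.κ₁) →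
      ∀ X : (𝒦 Z t).Λ ⊕ (𝒦 Z t).C₀ → ℝ, Γm Z t φ σ X = (𝒦 Z t).G2 σ (uOf Z t φ) *ᵥ fun j => (X j : ℂ))
    {γ₂ : ℝ} (hγ₂ : 0 ≤ γ₂)
    -- (3) uniform fibre bounds of the bond locations
    {m : ℕ}
    (hfibΛ : ∀ Z t (x : UT Nf), (Finset.univ.filter fun i => (𝒦 Z t).locΛ i = x).card ≤ m)
    (hfibN : ∀ Z t (x : UT Nf), (Finset.univ.filter fun j => (𝒦 Z t).locN j = x).card ≤ m)
    -- (3) THE REFERENCE RUNG ON THE TERMS OF THE STEP OF RECORD (the displayed hypothesis, n10-b's reference currency):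
    --     ONE admissible reference package `rf`, an accretivity radius `0 < R₁ < R`, print's two perturbative sources (p. 15:
    --     «O(1)e^{−⅓δ₀M} + O(α₀ + α₁)» against the reference positivity) as FOUR DIVISION-FREE THRESHOLDS, positive input
    --     rates and `η ≤ etaMax` of the W-walks package `rf.toWalkPackage R₁` (standard rate book: `κ_C = κ_C⋆`, `ρ′ = μ∕4`),
    --     `TermWalksRef` for the kernels of every term, round letters, and PRINT's TWO EXCHANGE THRESHOLDS for a `θ₀ > 0`
    (rf : RefPackage) (hrf : rf.Admissible) {R₁ : ℝ} (hR₁ : 0 < R₁) (hR₁R : R₁ < rf.R)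
    (hPσ : 8 * rf.KbarP * rf.cV₀ * Real.exp (-(rf.εP * rf.Rσ)) ≤ rf.m₀) (hP₁ : 8 * rf.KbarP * rf.cV₀ * R₁ ≤ rf.m₀ * rf.R)
    (hAσ : 8 * rf.KbarA * rf.cV * Real.exp (-(rf.εA * rf.Rσ)) ≤ rf.mA₀) (hA₁ : 8 * rf.KbarA * rf.cV * R₁ ≤ rf.mA₀ * rf.R)
    (hp : (rf.toWalkPackage R₁).PositiveRates) (hη : rf.η ≤ (rf.toWalkPackage R₁).etaMax) (hαR : α < R₁)
    -- (3) NODE A's KERNEL DATA READ OFF ONE OPERATOR PER TERM — print's `C*Δ_k(σ(Z),𝐔,𝐉)C` after the conditioning (2.5)–(2.6): block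
    --     reading; ONE expansion at `rf`'s full-precision letters whose terms are `s`-MONOMIALS times σ-free operators ([II] p. 3) and
    --     carry a WALK REVERSAL ([13] (3.107)); ONE positivity; geometry; dominations in `rf`
    (KK : (Z : TDom 4 (lam.n + 1)) → (t : Finset (TDom 4 ((θ.ℓ₆ + 1) * (lam.n + 1))) × Finset (TBond 4 (lam.m₃ + 1) ((θ.ℓ₆ + 1) * (lam.n + 1)))) →
      (TPt 4 (lam.n + 1) → ℂ) → E₃ → Matrix ((𝒦 Z t).Λ ⊕ (𝒦 Z t).C₀) ((𝒦 Z t).Λ ⊕ (𝒦 Z t).C₀) ℂ)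
    (hKA2 : ∀ Z t σ u, (𝒦 Z t).A2 σ u = (KK Z t σ u).toBlocks₁₁)
    (hKG2 : ∀ Z t σ u, (𝒦 Z t).G2 σ u
      = Matrix.fromCols (0 : Matrix (𝒦 Z t).Λ (𝒦 Z t).Λ ℂ) (KK Z t σ u).toBlocks₁₂ * invSqrt (KK Z t σ u))
    (hKloc : ∀ Z t i, (𝒦 Z t).locΛ i = (𝒦 Z t).locN (Sum.inl i))
    (hKX : ∀ Z, ∀ t ∈ terms (θ.ℓ₆ + 1) (lam.m₃ + 1) Z, (𝒦 Z t).X.Nonempty)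
    -- (3″) NODE A's OBJECT DATA AS ENTRYWISE LETTERS (census v5 class A2′ in its ENTRYWISE form ∧ A2″ as ONE geometric letter ∧ A2‴; replaces
    --      module 21's `hKexp`; ym-nodeO-ideate P2 g30's reduction, tree module `B13EntrywiseWalks`): per term, the fine-bond index `P Z t` located by
    --      `locF`; TWO ENTRYWISE LETTERS of the σ-free fluctuation operator `Δ₀ Z t` on the complex `rf.R`-ball — (3.108)-type decay
    --      `‖Δ₀(u)_{ij}‖ ≤ B·e^{−ρ·d₁(i,j)}` and entrywise holomorphy (`RawEntryLetters`) —, a fibre bound; the cube decoration `J` on PAIRS of fine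
    --      bonds with the GEODESIC letter (`|J(i,j)| ≤ c₀ + d₁(i,j)∕M₁`, a decorated pair joined by a `d₁`-geodesic through `(𝒦 Z t).X`); the (1.11)
    --      numerics `0 < η ≤ ε < ρ`, `2κ₁ ≤ ηM₁`; the REAL constant local averaging operator `C Z t` of (2.5) (`|C| ≤ 1`, range `rC`); a junction
    --      rate `μΔ`; the letter match with `rf`; and `KK Z t` IS `Cᵀ·sDecorate(J′, ½raw ⊕ ½rawᵀ)·C` (`hKK`)
    (P : TDom 4 (lam.n + 1) → Finset (TDom 4 ((θ.ℓ₆ + 1) * (lam.n + 1))) × Finset (TBond 4 (lam.m₃ + 1) ((θ.ℓ₆ + 1) * (lam.n + 1))) → Type)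
    [∀ Z t, Fintype (P Z t)] [∀ Z t, DecidableEq (P Z t)]
    (locF : (Z : TDom 4 (lam.n + 1)) → (t : Finset (TDom 4 ((θ.ℓ₆ + 1) * (lam.n + 1))) × Finset (TBond 4 (lam.m₃ + 1) ((θ.ℓ₆ + 1) * (lam.n + 1)))) →
      P Z t → UT Nf)
    (Δ₀ : (Z : TDom 4 (lam.n + 1)) → (t : Finset (TDom 4 ((θ.ℓ₆ + 1) * (lam.n + 1))) × Finset (TBond 4 (lam.m₃ + 1) ((θ.ℓ₆ + 1) * (lam.n + 1)))) →
      E₃ → Matrix (P Z t) (P Z t) ℂ)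
    {ρΔ BΔ εΔ κΔ ηΔ μΔ M₁ rC : ℝ} {mF c₀ : ℕ}
    (hEL : ∀ Z, ∀ t ∈ terms (θ.ℓ₆ + 1) (lam.m₃ + 1) Z, RawEntryLetters (Δ₀ Z t) (locF Z t) rf.R ρΔ BΔ)
    (hfibF : ∀ Z t (y : UT Nf), (Finset.univ.filter fun k => locF Z t k = y).card ≤ mF)
    (J : (Z : TDom 4 (lam.n + 1)) → (t : Finset (TDom 4 ((θ.ℓ₆ + 1) * (lam.n + 1))) × Finset (TBond 4 (lam.m₃ + 1) ((θ.ℓ₆ + 1) * (lam.n + 1)))) →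
      P Z t × P Z t → Finset (TPt 4 (lam.n + 1)))
    (hGJ : ∀ Z, ∀ t ∈ terms (θ.ℓ₆ + 1) (lam.m₃ + 1) Z, GeodesicDecoration (J Z t) (locF Z t) (𝒦 Z t).X c₀ M₁)
    (hηΔ : 0 < ηΔ) (hηε : ηΔ ≤ εΔ) (hρε : εΔ < ρΔ) (hP2 : 2 * cp.κ₁ ≤ ηΔ * M₁)
    (C : (Z : TDom 4 (lam.n + 1)) → (t : Finset (TDom 4 ((θ.ℓ₆ + 1) * (lam.n + 1))) × Finset (TBond 4 (lam.m₃ + 1) ((θ.ℓ₆ + 1) * (lam.n + 1)))) →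
      Matrix (P Z t) ((𝒦 Z t).Λ ⊕ (𝒦 Z t).C₀) ℝ)
    (hCle : ∀ Z t k i, |C Z t k i| ≤ 1)
    (hCsupp : ∀ Z t k i, C Z t k i ≠ 0 → tdist1 Nf (locF Z t k) ((𝒦 Z t).locN i) ≤ rC)
    (hμΔ : 0 < μΔ) (hμε : 2 * μΔ ≤ εΔ - ηΔ) (hμκ : 2 * μΔ ≤ κΔ) (hκεΔ : κΔ ≤ ρΔ - εΔ)
    (hεP : rf.εP ≤ εΔ - ηΔ - μΔ - μΔ) (hkapP : rf.kapP ≤ κΔ - μΔ - μΔ)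
    (hKP : (mF * B6.c0 1 μΔ ^ ν) * ((mF * B6.c0 1 μΔ ^ ν) * Real.exp ((ρΔ - ηΔ) * rC) *
      (Real.exp (cp.κ₁ * (2 * c₀ : ℕ)) * (BΔ * (mF * mF + 1))) * B6.c0 1 μΔ ^ ν) *
      Real.exp ((ρΔ - ηΔ - μΔ) * rC) * B6.c0 1 μΔ ^ ν ≤ rf.KbarP)
    (hKK : ∀ Z t σ u, KK Z t σ u =
      ((C Z t).map (algebraMap ℝ ℂ))ᵀ *
        sDecorate (fun ω : (P Z t × P Z t) ⊕ (P Z t × P Z t) => J Z t (Sum.elim id id ω))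
          (fun ω u => Sum.elim (fun ω => (1 / 2 : ℂ) • rawEntryTerm (Δ₀ Z t) ω u)
            (fun ω => (1 / 2 : ℂ) • (rawEntryTerm (Δ₀ Z t) ω u)ᵀ) ω) σ u *
        (C Z t).map (algebraMap ℝ ℂ))
    (hKacc : ∀ Z, ∀ t ∈ terms (θ.ℓ₆ + 1) (lam.m₃ + 1) Z, ∀ v : (𝒦 Z t).Λ ⊕ (𝒦 Z t).C₀ → ℂ,
      rf.m₀ * ∑ i, ‖v i‖ ^ 2 ≤ (∑ i, star (v i) * (KK Z t 0 0 *ᵥ v) i).re)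
    (hKfar : ∀ Z, ∀ t ∈ terms (θ.ℓ₆ + 1) (lam.m₃ + 1) Z, ∀ k, ∀ z ∈ (𝒦 Z t).X, rf.Rσ ≤ tdist1 Nf ((𝒦 Z t).locN k) z)
    (hKmult : ∀ Z, ∀ t ∈ terms (θ.ℓ₆ + 1) (lam.m₃ + 1) Z, ∀ x : UT Nf,
      (Finset.univ.filter fun k => (𝒦 Z t).locN k = x).card ≤ rf.nB)
    (hKdim : ν ≤ rf.dm)
    (hεL : rf.εL ≤ rf.εP) (hκL : rf.kapL ≤ rf.kapP) (hKL : rf.KbarP ≤ rf.KbarL)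
    (hεA : rf.εA ≤ rf.εP) (hκA : rf.kapA ≤ rf.kapP) (hKA : rf.KbarP ≤ rf.KbarA) (hmA : rf.mA₀ ≤ rf.m₀)
    {KG KCs θ₀ : ℝ} (hKG : (rf.toWalkPackage R₁).Kbar ≤ KG) (hKCs : 8 / rf.mA₀ ≤ KCs) (hθ₀ : 0 < θ₀)
    (hαsmall : α ≤ θ₀ * R₁ / (4 * (rf.toWalkPackage R₁).Kbar + 4))
    (hRσlarge : Real.log ((4 * (rf.toWalkPackage R₁).Kbar + 4) / θ₀)
      / ((rf.toWalkPackage R₁).mu / 4 - (rf.toWalkPackage R₁).kapCStar) ≤ rf.Rσ)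
    -- (3) rates below the package's κ_C⋆, and NODE A's letter ϑ (θ_Γ = θ_E = θ₀, K_Γ = K_G, K₀′ = K_Cs, θ_C derived)
    {kap kap' kap'' kap₂ ϑ : ℝ} (hkap'' : 0 < kap'') (hk1 : kap'' < kap') (hk2 : kap' < kap) (hk3 : kap < kap₂)
    (hk4 : kap₂ < (rf.toWalkPackage R₁).kapCStar) (hθ₀le : θ₀ ≤ ϑ)
    (hθR1le : (m * (1 + 2 / (kap - kap')) ^ ν) * (m * (1 + 2 / (kap' - kap'')) ^ ν)
      * (θ₀ * KCs * KG
        + KG * (KCs * θ₀ * (m * (1 + 2 / ((rf.toWalkPackage R₁).kapCStar - kap₂)) ^ ν) * KCs * (m * (1 + 2 / (kap₂ - kap)) ^ ν)) * KG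
        + KG * KCs * θ₀) ≤ ϑ)
    (hsmallKθ : KCs * (m * (1 + 2 / kap) ^ ν) * (ϑ * (m * (1 + 2 / kap'') ^ ν)) < 1)
    -- (3) the (2.24)–(2.25) smallness with `a₂₀ = 2·m′·α₄·M⁻⁴(1 + 32/(κ₁−1))⁴`; the eigenvalue bound of C is the NUMBER
    --     `2∕m_{A,0} ≤ cE`; the form bound of Γ₀ is the NUMBER `g = B_Γ²c_V·m c₀(1,η)^ν∕(m_{A,0}∕2)`
    {cE : ℝ} (hc0 : 0 ≤ cE)
    (hcE : 2 / rf.mA₀ ≤ cE)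
    (hαc : (2 * (ϑ * (m * (1 + 2 / kap'') ^ ν)) +
      (γ₂ + 2 * (m' * lam.c.α₄ * (lam.c.M ^ 4)⁻¹ * (1 + 32 / (lam.c.κ₁ - 1)) ^ 4))) * cE ≤ 1 / 2)
    (hsmall : (2 * (ϑ * (m * (1 + 2 / kap'') ^ ν)) +
      (γ₂ + 2 * (m' * lam.c.α₄ * (lam.c.M ^ 4)⁻¹ * (1 + 32 / (lam.c.κ₁ - 1)) ^ 4))) * (1 + 2 * cE * (((rf.toWalkPackage R₁).BΓ * rf.cV) * ((rf.toWalkPackage R₁).BΓ * (m * B6.c0 1 rf.η ^ ν)) / (rf.mA₀ / 2))) ≤ 1 / 2)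
    -- (3) constant matching, p. 17: `a ≤ γ₂ r_P²` and the volume factor with `w = 2·K₀(64,8)·α₄·#(⋃𝐃)`
    (hPa : a ≤ γ₂ * rP ^ 2)
    (hvol : ∀ Z, ∀ t ∈ terms (θ.ℓ₆ + 1) (lam.m₃ + 1) Z,
      2 * (KCs * (m * (1 + 2 / kap) ^ ν) * (ϑ * (m * (1 + 2 / kap'') ^ ν))
              * (1 + (1 - KCs * (m * (1 + 2 / kap) ^ ν) * (ϑ * (m * (1 + 2 / kap'') ^ ν)))⁻¹) / 2)
          * (Fintype.card (𝒦 Z t).Λ : ℝ)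
        + 2 * (K₀ 64 8 * lam.c.α₄ * ((((Dfam Z t).image Subtype.val).biUnion id).card : ℝ))
        + (2 * (ϑ * (m * (1 + 2 / kap'') ^ ν)) +
            (γ₂ + 2 * (m' * lam.c.α₄ * (lam.c.M ^ 4)⁻¹ * (1 + 32 / (lam.c.κ₁ - 1)) ^ 4))) * cE * (Fintype.card (𝒦 Z t).Λ : ℝ)
        + (2 * (ϑ * (m * (1 + 2 / kap'') ^ ν)) +
            (γ₂ + 2 * (m' * lam.c.α₄ * (lam.c.M ^ 4)⁻¹ * (1 + 32 / (lam.c.κ₁ - 1)) ^ 4))) * (1 + 2 * cE * (((rf.toWalkPackage R₁).BΓ * rf.cV) * ((rf.toWalkPackage R₁).BΓ * (m * B6.c0 1 rf.η ^ ν)) / (rf.mA₀ / 2)))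
            * (Fintype.card ((𝒦 Z t).Λ ⊕ (𝒦 Z t).C₀) : ℝ)
        ≤ a₅ * ((Z.1).card : ℝ)) :
    B13LeafOfRecord θ lam := by
  -- `0 ≤ cp.κ₁` from the located κ₁ thresholds of Lemma 1 and `lam.c.κ₁ < cp.κ₁`
  have hcpκ₁ : 0 ≤ cp.κ₁ := by
    have hlog : 0 ≤ Real.log (8 * 12 ^ 3) := Real.log_nonneg (by norm_num)
    linarith
  -- module 21's structured binder `hKexp`, DERIVED from the entrywise letters (module 31), transported along `hKK`, weakened to rf's letters
  have hKexp : ∀ Z, ∀ t ∈ terms (θ.ℓ₆ + 1) (lam.m₃ + 1) Z,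
      ∃ (W' : Type) (T : W' → (TPt 4 (lam.n + 1) → ℂ) → E₃ → Matrix ((𝒦 Z t).Λ ⊕ (𝒦 Z t).C₀) ((𝒦 Z t).Λ ⊕ (𝒦 Z t).C₀) ℂ)
        (SX : Set W') (A' : W' → ℝ) (D' : W' → UT Nf → UT Nf → ℝ) (ρ : ℝ)
        (J' : W' → Finset (TPt 4 (lam.n + 1))) (T0 : W' → E₃ → Matrix ((𝒦 Z t).Λ ⊕ (𝒦 Z t).C₀) ((𝒦 Z t).Λ ⊕ (𝒦 Z t).C₀) ℂ)
        (rev : W' ≃ W'),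
        JointWalkExpansion cp (𝒦 Z t).locN (𝒦 Z t).locN (KK Z t) (𝒦 Z t).X rf.R rf.εP rf.kapP rf.KbarP T SX A' D' ρ ∧
        (∀ ω σ u, T ω σ u = (∏ j ∈ J' ω, σ j) • T0 ω u) ∧ (∀ ω σ u i j, T (rev ω) σ u i j = T ω σ u j i) := by
    intro Z t ht
    have hB : 0 ≤ BΔ := (hEL Z t ht).B_nonneg
    have hKS0 : 0 ≤ (mF * B6.c0 1 μΔ ^ ν) * ((mF * B6.c0 1 μΔ ^ ν) * Real.exp ((ρΔ - ηΔ) * rC) *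
        (Real.exp (cp.κ₁ * (2 * c₀ : ℕ)) * (BΔ * (mF * mF + 1))) * B6.c0 1 μΔ ^ ν) *
        Real.exp ((ρΔ - ηΔ - μΔ) * rC) * B6.c0 1 μΔ ^ ν := by
      have hc : 0 ≤ B6.c0 1 μΔ ^ ν := pow_nonneg (B6RandomWalk.c0_nonneg 1 μΔ) ν
      positivity
    obtain ⟨W', T', SX', A', D', ρ', J', T0', rev', hJ, hmono, hrev⟩ :=
      structuredExpansion_sandwich_rawEntrywise (d := 4) (N' := lam.n + 1) hcpκ₁ (hKX Z t ht) (hEL Z t ht) (hfibF Z t)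
        (hGJ Z t ht) hηΔ hηε hρε hP2 (C Z t) (hCle Z t) (hCsupp Z t) hμΔ hμε hμκ hκεΔ
    refine ⟨W', T', SX', A', D', ρ', J', T0', rev', ?_, hmono, hrev⟩
    exact (jointWalkExpansion_congr_on hJ (fun σ _ u _ => (hKK Z t σ u).symm)).mono le_rfl hεP hkapP hKS0 hKP
  exact b13LeafOfRecord_of_located_conditionedMonomialHolo θ lam hN12 dist hS0Y hFsub hSq hScY hdist0 hdist hSX hSX' hX0 hAnT hAnT' hK hK' hκ hδ1 hδκ hκ126 hκ126' hκ₁ hκ₁' hδ₀M hδ₀M5 hR8 hR9 h124 h130 hθ₁0 hθ₁1 hC hGlAn hGl he hg hK₂ hR hε3 hW hKW hcard hsp hfloor hAnP hG hL8 hN h12 hE hε hC₁ hα hM hτ2 cp hκp hr hr1 𝒦 uOf hαnn huα lZ hlZ lD hlD Γm χY₀ χcP hχ0 hχ1 Pl hPcard hrP hχc Dfam Vr hT₃ ιb hι cube hQsupp hfibc emb hBv hBv0 hVr hχsupp hχm hVm hsmallm hlin hγ₂ hfibΛ hfibN rf hrf hR₁ hR₁R hPσ hP₁ hAσ hA₁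 hp hη hαR KK hKA2 hKG2 hKloc hKX hKexp hKacc hKfar hKmult hKdim hεL hκL hKL hεA hκA hKA hmA hKG hKCs hθ₀ hαsmall hRσlarge hkap'' hk1 hk2 hk3 hk4 hθ₀le hθR1le hsmallKθ hc0 hcE hαc hsmall hPa hvol

end Group

end Summit.QuantumFields.YangMills.BalabanUVNodes.N10AtRecord11B13WalksBlockEntrywise

end
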